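import Summits.Ventures.Crystal3D.Theorems.StickyWulffConstantNoReconstructionGainExactThinNoCriminal
import HarnessLib

/-!
# No criminal has a `7/20`-thin off-lattice part (sharper constant; line `replication-exactness`)

HONEST FRAMING. Part of the venture `Summits/Ventures/Crystal3D` (cell `crystal3d-full`), supports the
crux `NoReconstructionGain` (stmt-Ventures-19144, route `route-Ventures-StickyWulffConstant`), line
`replication-exactness` (lead wulff-p1 g18).  Same argument as `…ExactThinNoCriminal` with the
thinness constant improved from `1/4` to `7/20`: in the planar step the bound
`‖z − z'‖² ≤ r² + r'² − 2·(59/100)·r r'` is maximised over `r, r' ∈ [7/8, 1]` at `r = r' = 1`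
(value `41/50 < 7/8`) instead of being estimated through `r r' ≥ r_min²`.  (With the exact value of
`cos (2π/7)` the method reaches thickness `< 0.497`; the planar-Euler route would give `< 1/√2`.)

* `seven_planar_false'`, `seven_thin_unit_vectors_false'` — the bricks with `7/8`, `7/20`;
* `not_isCriminal_of_locallyThin_offLattice'` — **no criminal each of whose off-lattice balls is,
  with its off-lattice partners, `7/20`-thin in some direction of its own**, on any face.

WHAT THIS IS NOT: the crux; rung F-C1 not moved.
-/

noncomputable section

namespace Summit.Ventures.Crystal3D.Theorems

open Summit.Ventures.Crystal3D
open Literature.MathematicalPhysics.StatisticalMechanics (fccStacking)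
open scoped InnerProductSpace Real
open Finset

/-- Seven planar vectors of norm² in `[7/8, 1]` are not pairwise at distance² `≥ 7/8` (sharper
constant than `seven_planar_false`: the quadratic `r² + r'² − 2·0.59·r r'` is maximal at `r = r' = 1`). -/
theorem seven_planar_false' (z : Fin 7 → ℂ) (hlo : ∀ i, 7 / 8 ≤ ‖z i‖ ^ 2) (hhi : ∀ i, ‖z i‖ ^ 2 ≤ 1)
    (hsep : ∀ i j, i ≠ j → 7 / 8 ≤ ‖z i - z j‖ ^ 2) : False := by
  have hne : ∀ i, z i ≠ 0 := by
    intro i h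
    have := hlo i
    rw [h, norm_zero] at this
    norm_num at this
  obtain ⟨i, j, hij, hcos⟩ := exists_cos_sub_ge (fun i => Complex.arg (z i))
    (fun i => Complex.neg_pi_lt_arg _) (fun i => Complex.arg_le_pi _)
  have hc := cos_two_pi_div_seven_ge
  have hre := re_mul_add_im_mul (z i) (z j) (hne i) (hne j)
  have hexp : ‖z i - z j‖ ^ 2 = ‖z i‖ ^ 2 + ‖z j‖ ^ 2 - 2 * ((z i).re * (z j).re + (z i).im * (z j).im) := by
    rw [Complex.sq_norm, Complex.sq_norm, Complex.sq_norm, Complex.normSq_apply, Complex.normSq_apply,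
      Complex.normSq_apply, Complex.sub_re, Complex.sub_im]
    ring
  have hn1 : ‖z i‖ ≤ 1 := by nlinarith [hhi i, norm_nonneg (z i)]
  have hn1' : ‖z j‖ ≤ 1 := by nlinarith [hhi j, norm_nonneg (z j)]
  have hn0 : 7 / 8 ≤ ‖z i‖ := by nlinarith [hlo i, norm_nonneg (z i)]
  have hn0' : 7 / 8 ≤ ‖z j‖ := by nlinarith [hlo j, norm_nonneg (z j)]
  have hcos' : 59 / 100 ≤ Real.cos (Complex.arg (z i) - Complex.arg (z j)) := hc.trans hcos
  -- `‖z i - z j‖² ≤ r² + r'² − 2·(59/100)·r r' ≤ 41/50 < 7/8`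
  have key : ‖z i‖ * ‖z j‖ * (59 / 100) ≤
      ‖z i‖ * ‖z j‖ * Real.cos (Complex.arg (z i) - Complex.arg (z j)) :=
    mul_le_mul_of_nonneg_left hcos' (mul_nonneg (norm_nonneg _) (norm_nonneg _))
  have := hsep i j hij
  rw [hexp, hre] at this
  nlinarith [mul_nonneg (sub_nonneg.2 hn1) (sub_nonneg.2 hn1'), mul_nonneg (sub_nonneg.2 hn1) (sub_nonneg.2 hn0),
    mul_nonneg (sub_nonneg.2 hn1') (sub_nonneg.2 hn0'), mul_nonneg (sub_nonneg.2 hn0) (sub_nonneg.2 hn0')]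

/-- **Seven near-horizontal unit vectors pairwise a unit apart do not exist** (heights `≤ 7/20`). -/
theorem seven_thin_unit_vectors_false' (e : EuclideanSpace ℝ (Fin 3)) (he : ‖e‖ = 1)
    (w : Fin 7 → EuclideanSpace ℝ (Fin 3)) (hw1 : ∀ i, ‖w i‖ = 1) (hwe : ∀ i, |⟪w i, e⟫_ℝ| ≤ 7 / 20)
    (hsep : ∀ i j, i ≠ j → 1 ≤ ‖w i - w j‖) (hthin : ∀ i j, |⟪w i - w j, e⟫_ℝ| ≤ 7 / 20) : False := by
  -- rotate `e` to the third axis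
  set e₃ : EuclideanSpace ℝ (Fin 3) := EuclideanSpace.single 2 1 with he₃def
  have he₃ : ‖e₃‖ = 1 := by rw [he₃def, PiLp.norm_single, norm_one]
  have hin3 : ∀ v : EuclideanSpace ℝ (Fin 3), ⟪v, e₃⟫_ℝ = v 2 := by
    intro v; rw [he₃def, EuclideanSpace.inner_single_right]; simp
  set A := (ℝ ∙ (e - e₃))ᗮ.reflection with hA
  have hAe : A e = e₃ := by rw [hA]; exact Submodule.reflection_sub (by rw [he, he₃])
  set a : Fin 7 → EuclideanSpace ℝ (Fin 3) := fun i => A (w i) with ha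
  have ha2 : ∀ i, a i 2 = ⟪w i, e⟫_ℝ := by
    intro i; rw [← hin3, ha, ← hAe, LinearIsometryEquiv.inner_map_map]
  have hasub : ∀ i j, a i - a j = A (w i - w j) := by intro i j; rw [ha, map_sub]
  have ha2' : ∀ i j, (a i - a j) 2 = ⟪w i - w j, e⟫_ℝ := by
    intro i j; rw [← hin3, hasub, ← hAe, LinearIsometryEquiv.inner_map_map]
  have hna : ∀ i, ‖a i‖ = 1 := by intro i; rw [ha, LinearIsometryEquiv.norm_map, hw1]
  have hna' : ∀ i j, ‖a i - a j‖ = ‖w i - w j‖ := by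
    intro i j; rw [hasub, LinearIsometryEquiv.norm_map]
  have hsq : ∀ v : EuclideanSpace ℝ (Fin 3), ‖v‖ ^ 2 = v 0 ^ 2 + v 1 ^ 2 + v 2 ^ 2 := by
    intro v; rw [EuclideanSpace.real_norm_sq_eq, Fin.sum_univ_three]
  -- the horizontal parts as complex numbers
  set z : Fin 7 → ℂ := fun i => ⟨a i 0, a i 1⟩ with hz
  have hzn : ∀ i, ‖z i‖ ^ 2 = 1 - ⟪w i, e⟫_ℝ ^ 2 := by
    intro i
    rw [Complex.sq_norm, hz, Complex.normSq_mk, ← ha2 i]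
    have := hsq (a i); rw [hna i, one_pow] at this
    nlinarith [this]
  have hzd : ∀ i j, ‖z i - z j‖ ^ 2 = ‖w i - w j‖ ^ 2 - ⟪w i - w j, e⟫_ℝ ^ 2 := by
    intro i j
    have e1 : z i - z j = ⟨(a i - a j) 0, (a i - a j) 1⟩ := by
      rw [hz]; apply Complex.ext <;> simp
    rw [Complex.sq_norm, e1, Complex.normSq_mk, ← ha2' i j, ← hna' i j]
    have := hsq (a i - a j)
    nlinarith [this]
  refine seven_planar_false' z (fun i => ?_) (fun i => ?_) (fun i j hij => ?_)
  · rw [hzn]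
    have h := hwe i; rw [abs_le] at h
    nlinarith [h.1, h.2]
  · rw [hzn]; nlinarith [sq_nonneg ⟪w i, e⟫_ℝ]
  · rw [hzd]
    have h := hthin i j; rw [abs_le] at h
    have h1 := hsep i j hij
    have h2 : 1 ≤ ‖w i - w j‖ ^ 2 := by nlinarith [h1]
    nlinarith [h.1, h.2, h2]

open scoped Classical in
/-- **No criminal is locally `7/20`-thin** (sharper constant than `not_isCriminal_of_locallyThin_offLattice`).  If every off-lattice ball `q` of a film on `H(ν,s)` admits a
unit vector `e` (depending on `q`) such that `q` and its off-lattice film partners have `e`-heights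
within `7/20` of each other — a locally flat, possibly curved, sheet of off-lattice balls over an
arbitrary registry part — the film is not a criminal, on any face. -/
theorem not_isCriminal_of_locallyThin_offLattice' {ν : EuclideanSpace ℝ (Fin 3)} {s : ℝ}
    {Q : Finset (EuclideanSpace ℝ (Fin 3))}
    (hthin : ∀ q ∈ Q, q ∉ fccStacking 1 (Real.sqrt (2 / 3)) →
      ∃ e : EuclideanSpace ℝ (Fin 3), ‖e‖ = 1 ∧
        ∀ x ∈ Q, ∀ y ∈ Q, x ∉ fccStacking 1 (Real.sqrt (2 / 3)) → y ∉ fccStacking 1 (Real.sqrt (2 / 3)) →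
          (x = q ∨ dist q x = 1) → (y = q ∨ dist q y = 1) → |⟪x - y, e⟫_ℝ| ≤ 7 / 20) :
    ¬ IsCriminal ν s Q := by
  intro hcrim
  obtain ⟨q, hq, hqΛ, -, -, h7⟩ := exists_offLattice_ten_contacts_of_criminal hcrim
  obtain ⟨e, he, hth⟩ := hthin q hq hqΛ
  obtain ⟨T, hT, hTc⟩ := Finset.exists_subset_card_eq h7
  set g := (T.equivFinOfCardEq hTc).symm with hg
  have hmem : ∀ i, ((g i : EuclideanSpace ℝ (Fin 3)) ∈ Q ∧
      (g i : EuclideanSpace ℝ (Fin 3)) ∉ fccStacking 1 (Real.sqrt (2 / 3)) ∧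
      dist q (g i) = 1) := by
    intro i
    have h := hT (g i).2
    rw [Finset.mem_filter] at h
    exact ⟨h.1, h.2.1, h.2.2⟩
  refine seven_thin_unit_vectors_false' e he (fun i => (g i : EuclideanSpace ℝ (Fin 3)) - q)
    (fun i => ?_)
    (fun i => hth _ (hmem i).1 q hq (hmem i).2.1 hqΛ (Or.inr (hmem i).2.2) (Or.inl rfl))
    (fun i j hij => ?_) (fun i j => ?_)
  · rw [← dist_eq_norm, dist_comm]; exact (hmem i).2.2
  · have hne : (g i : EuclideanSpace ℝ (Fin 3)) ≠ g j := fun h =>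
      hij (g.injective (Subtype.ext h))
    have e1 : (g i : EuclideanSpace ℝ (Fin 3)) - q - ((g j : EuclideanSpace ℝ (Fin 3)) - q) =
        (g i : EuclideanSpace ℝ (Fin 3)) - g j := by abel
    rw [e1, ← dist_eq_norm]
    exact hcrim.1.1 _ (hmem i).1 _ (hmem j).1 hne
  · have e1 : (g i : EuclideanSpace ℝ (Fin 3)) - q - ((g j : EuclideanSpace ℝ (Fin 3)) - q) =
        (g i : EuclideanSpace ℝ (Fin 3)) - g j := by abel
    rw [e1]
    exact hth _ (hmem i).1 _ (hmem j).1 (hmem i).2.1 (hmem j).2.1 (Or.inr (hmem i).2.2)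
      (Or.inr (hmem j).2.2)

end Summit.Ventures.Crystal3D.Theorems

end
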